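import Mathlib
import HarnessLib

/-!
# Item `LrcModEntire` (stmt-NavierStokesRegularity-20428), registry twist_split v7 — FRAME ALGEBRA ON A HOT ARC (memo `Cruxes/LrcModEntire/T2B-g14.md` §10, capstone steps (3)–(5)):
# the Hessian annihilates the tangent of a critical arc, and `D²f[ν,ν] + D²f[τ,τ] = ∂₀²f + ∂₁²f` in a rotated horizontal frame

LEAD of item 20428 ns-poloidal-K2-p3 g14 (`--supports stmt-NavierStokesRegularity-20428 --as helper`).  CLASS-FREE calculus turning the (TH) RIDGE LAW (`…TwistingTHRidgeLaw`: the horizontal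
Laplacian `∂₀²v₂ + ∂₁²v₂` of the slice `−1` is constant on the hot set) into the hypothesis «`κ(s) = −σD²v₂(γ(s))[ν(s),ν(s)]` constant along the arc» of `…RidgeTwist.quasiconvexOn_sq_nuZ_of_class`:

* `fderiv_fderiv_tangent_eq_zero` — if `f ∈ C²` and `Df(γ(t)) = 0` for all `t` near `s` along a curve `γ` with velocity `γ′` at `s`, then `D²f(γ(s))[γ′, w] = 0` for every `w`
  (the Hessian kills the tangent direction of a CRITICAL arc: `t ↦ Df(γ(t))` is constant);
* `fderiv_fderiv_frame_sum` — for a rotated horizontal frame `ν = a e₀ + b e₁`, `τ = −b e₀ + a e₁` with `a² + b² = 1`: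
  `D²f(y)[ν,ν] + D²f(y)[τ,τ] = D²f(y)[e₀,e₀] + D²f(y)[e₁,e₁]` (bilinearity only);
* `fderiv_fderiv_normal_eq_horizLaplacian` — consequently, on a critical arc with horizontal unit tangent `τ` and normal `ν` as above, `D²f(γ(s))[ν,ν] = D²f[e₀,e₀] + D²f[e₁,e₁]`
  at `γ(s)`: the transversal curvature of the ridge IS the horizontal Laplacian there, so the ridge law makes it constant along the arc.

WHAT THIS IS NOT: not a claim about Navier–Stokes regularity — calculus for `stub_T2b` (bears_on LADDER-NS N0, item 20428 / crux 19708; both OPEN, ⟨27893⟩ OPEN).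
-/

noncomputable section

-- the summit and its single sub-problem share the name (CONVENTIONS §1), as in every Theorems file
set_option linter.dupNamespace false

namespace Summit.NavierStokesRegularity.NavierStokesRegularity.Theorems.PoloidalWindowDoorLrcModEntireRidgeFrame

open Set Function Filter Topology

variable {E : Type*} [NormedAddCommGroup E] [NormedSpace ℝ E]

/-- **The Hessian annihilates the tangent of a critical arc.**  `f ∈ C²`, `γ` with velocity `γ′` at `s`, `Df(γ(t)) = 0` for `t` near `s` ⇒ `D²f(γ(s))[γ′] = 0` (as a linear form),
in particular `D²f(γ(s))[γ′, w] = 0` for all `w`. -/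
theorem fderiv_fderiv_tangent_eq_zero {f : E → ℝ} (hf : ContDiff ℝ 2 f) {γ : ℝ → E} {γ' : E} {s : ℝ} (hγ : HasDerivAt γ γ' s)
    (hcrit : ∀ᶠ t in 𝓝 s, fderiv ℝ f (γ t) = 0) (w : E) : fderiv ℝ (fderiv ℝ f) (γ s) γ' w = 0 := by
  have hd : Differentiable ℝ (fderiv ℝ f) := (hf.fderiv_right (m := 1) (by norm_num)).differentiable one_ne_zero
  -- the chain rule for `t ↦ Df(γ t)`
  have h1 : HasDerivAt (fun t => fderiv ℝ f (γ t)) (fderiv ℝ (fderiv ℝ f) (γ s) γ') s :=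
    (hd (γ s)).hasFDerivAt.comp_hasDerivAt s hγ
  -- and it is eventually the constant `0`
  have h2 : HasDerivAt (fun t => fderiv ℝ f (γ t)) (0 : E →L[ℝ] ℝ) s :=
    (hasDerivAt_const s (0 : E →L[ℝ] ℝ)).congr_of_eventuallyEq (hcrit.mono fun t ht => ht)
  have h := h1.unique h2
  rw [h]; rfl

/-- **Rotated horizontal frame.**  For `ν = a e₀ + b e₁`, `τ = −b e₀ + a e₁` with `a² + b² = 1` and any `C²`-point data: `D²f(y)[ν,ν] + D²f(y)[τ,τ] = D²f(y)[e₀,e₀] + D²f(y)[e₁,e₁]`. -/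
theorem fderiv_fderiv_frame_sum (B : E →L[ℝ] E →L[ℝ] ℝ) {e₀ e₁ ν τ : E} {a b : ℝ} (hab : a ^ 2 + b ^ 2 = 1)
    (hν : ν = a • e₀ + b • e₁) (hτ : τ = -b • e₀ + a • e₁) :
    B ν ν + B τ τ = B e₀ e₀ + B e₁ e₁ := by
  rw [hν, hτ]
  simp only [map_add, map_smul, map_neg, add_apply, neg_apply, FunLike.coe_smul, Pi.smul_apply, smul_eq_mul, neg_smul]
  linear_combination (B e₀ e₀ + B e₁ e₁) * hab

/-- **On a critical arc the transversal second derivative is the horizontal Laplacian.**  `f ∈ C²`; `γ` critical near `s` with velocity `γ′(s) = c•τ`, `τ = −b e₀ + a e₁`,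
`ν = a e₀ + b e₁`, `a² + b² = 1`, `c ≠ 0` ⇒ `D²f(γ(s))[ν,ν] = D²f(γ(s))[e₀,e₀] + D²f(γ(s))[e₁,e₁]`. -/
theorem fderiv_fderiv_normal_eq_horizLaplacian {f : E → ℝ} (hf : ContDiff ℝ 2 f) {γ : ℝ → E} {s : ℝ} {e₀ e₁ ν τ : E} {a b c : ℝ}
    (hab : a ^ 2 + b ^ 2 = 1) (hν : ν = a • e₀ + b • e₁) (hτ : τ = -b • e₀ + a • e₁) (hc : c ≠ 0)
    (hγ : HasDerivAt γ (c • τ) s) (hcrit : ∀ᶠ t in 𝓝 s, fderiv ℝ f (γ t) = 0) :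
    fderiv ℝ (fderiv ℝ f) (γ s) ν ν = fderiv ℝ (fderiv ℝ f) (γ s) e₀ e₀ + fderiv ℝ (fderiv ℝ f) (γ s) e₁ e₁ := by
  have hsum := fderiv_fderiv_frame_sum (fderiv ℝ (fderiv ℝ f) (γ s)) hab hν hτ
  have hzero : fderiv ℝ (fderiv ℝ f) (γ s) τ τ = 0 := by
    have h := fderiv_fderiv_tangent_eq_zero hf hγ hcrit τ
    rw [map_smul, FunLike.coe_smul, Pi.smul_apply, smul_eq_mul] at h
    rcases mul_eq_zero.1 h with h0 | h0
    · exact absurd h0 hc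
    · exact h0
  linarith

end Summit.NavierStokesRegularity.NavierStokesRegularity.Theorems.PoloidalWindowDoorLrcModEntireRidgeFrame
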